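import Mathlib
import HarnessLib
import HarnessLib.Audit
import Summits.Langlands.Statement
import Summits.Langlands.Langlands.Theses.PrimeSwitchSplit
import Literature.AlgebraicGeometry.Motives.Varieties
import Literature.AlgebraicGeometry.Motives.GaloisRealization
import Literature.AlgebraicGeometry.Motives.EllAdicEtaleRational
import Summits.Langlands.Langlands.Theses.MotivicDictionarySplit

/-! BC3 birth skeleton for crux `AbelianMotivicReciprocity` of the child route MotivicDictionarySplit v2.1 (kit of record HOME/lens-3/g24/mds21/route.json 6c1b2dc4; statements == v2 g23,
verified byte-identical by the generator) — lens-3 g26, POST-BIRTH form in the writer-1 v2 SHAPE (bus L1461/L2052): stubs sorried (texts UNCHANGED from the g23 births,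
crit row 326/356 lineage); `AbelianMotivicReciprocity_of` keeps its stub-text hypotheses and concludes `id <RouteDecl>` (`dsimp only [id]`, proof body unchanged); EXACTLY ONE hypothesis-free
theorem `abelianMotivicReciprocity_proof : Summit.Langlands.Langlands.Theses.MotivicDictionarySplit.AbelianMotivicReciprocity` concludes the route decl BY NAME.  Pre-birth audit twin: `…AbelianMotivicReciprocity.preskel.lean`
(local copy of the decl in namespace `Summit.Langlands.Langlands.Theses.MotivicDictionarySplit` + `#h21_check_skeleton`). -/

set_option linter.dupNamespace false
set_option linter.unusedVariables false

namespace Summit.Langlands.Langlands.Cruxes.AbelianMotivicReciprocity.Birth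

/-- BC5 RUNG (plan-only, PRINT): n = 2 over K = ℚ. A 2-dimensional irreducible subquotient W of H¹(X_ℚ̄, ℚ̄_ℓ)(ε^j) = V_ℓ(Alb X)^∨(j) is cut out by a ℚ-rational idempotent of End⁰(Alb X) ⊗ ℚ̄ (Faltings 1983: semisimplicity + Tate), hence is the λ-adic realisation of a rank-2 motive over ℚ with Hodge types (0,1),(1,0): ODD and HT-regular by Hodge symmetry (F_∞ swaps H^{1,0}, H^{0,1}), pure of weight 1 (so every λ-adic member is irreducible); Serre's conjecture (Khare–Wintenberger 2009) + Kisin 2009 / Skinner–Wiles ⇒ W ≅ ρ_{f,λ} for a weight-2 newform f (Ribet: GL₂-type ⇒ modular) ⇒ cuspidal L-algebraic π on GL₂/ℚ with Satake = Frobenius at almost all p. OUTSIDE S's known regime: B_w(n = 2, K = ℚ) contains the even icosahedral Artin ρ (open); the rung holds BECAUSE of geometric origin (oddness, regularity, compatible system) — the route's lever -/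
theorem stub_abelianReciprocity_dimTwo_rational :
    ∀ (K : Type) [Field K] [NumberField K] (n : ℕ) (hcpt : Literature.NumberTheory.Automorphic.isCompact_glFiniteIntegralLevel n K), 0 < n → ∀ (ℓ : ℕ) [Fact ℓ.Prime] (ι : PadicAlgCl ℓ ≃+* ℂ) (ρ : Literature.NumberTheory.GaloisRepresentations.FramedGaloisRep K (PadicAlgCl ℓ) n), ρ.toGaloisRep.IsIrreducible → n = 2 → Module.finrank ℚ K = 1 → ((∀ᶠ v : IsDedekindDomain.HeightOneSpectrum (NumberField.RingOfIntegers K) in Filter.cofinite, ρ.IsUnramifiedAt v) ∧ ∀ (v : IsDedekindDomain.HeightOneSpectrum (NumberField.RingOfIntegers K)) (hv : ((ℓ : ℕ) : NumberField.RingOfIntegers K) ∈ v.asIdeal), (Literature.NumberTheory.PAdicHodge.fontainePstAdicCompletion v ℓ hv).IsDeRhamFramed (ρ.toLocal v)) → (∃ (d : ℕ) (X : Literature.AlgebraicGeometry.Motives.SchemeOver K), Literature.AlgebraicGeometry.Motives.IsSmoothProjective d X ∧ ∃ (j : ℤ) (W : Submodule (PadicAlgCl ℓ) (TensorProduct ℚ_[ℓ]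 (PadicAlgCl ℓ) (Literature.AlgebraicGeometry.Motives.ellAdicEtaleCohomologyRat ℓ 1 (Literature.AlgebraicGeometry.Motives.geometricFibre K X)))) (hW : ∀ (g : Field.absoluteGaloisGroup K) (w : TensorProduct ℚ_[ℓ] (PadicAlgCl ℓ) (Literature.AlgebraicGeometry.Motives.ellAdicEtaleCohomologyRat ℓ 1 (Literature.AlgebraicGeometry.Motives.geometricFibre K X))), w ∈ W → (algebraMap ℚ_[ℓ] (PadicAlgCl ℓ) ((Literature.AlgebraicGeometry.Motives.padicCyclotomicCharacter K ℓ g : ℚ_[ℓ]ˣ) : ℚ_[ℓ])) ^ j • (Literature.AlgebraicGeometry.Motives.geometricEllAdicEtaleCohomologyRepRat ℓ X 1 g).baseChange (PadicAlgCl ℓ) w ∈ W) (f : W →ₗ[PadicAlgCl ℓ] (Fin n → PadicAlgCl ℓ)), Function.Surjective f ∧ ∀ (g : Field.absoluteGaloisGroup K) (w : W), f ⟨(algebraMap ℚ_[ℓ] (PadicAlgCl ℓ) ((Literature.AlgebraicGeometry.Motives.padicCyclotomicCharacter K ℓ g : ℚ_[ℓ]ˣ) : ℚ_[ℓ])) ^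 j • (Literature.AlgebraicGeometry.Motives.geometricEllAdicEtaleCohomologyRepRat ℓ X 1 g).baseChange (PadicAlgCl ℓ) (w : TensorProduct ℚ_[ℓ] (PadicAlgCl ℓ) (Literature.AlgebraicGeometry.Motives.ellAdicEtaleCohomologyRat ℓ 1 (Literature.AlgebraicGeometry.Motives.geometricFibre K X))), hW g w w.2⟩ = ((ρ g : GL (Fin n) (PadicAlgCl ℓ)) : Matrix (Fin n) (Fin n) (PadicAlgCl ℓ)).mulVec (f w)) → ∃ π : Literature.NumberTheory.Automorphic.CuspidalAutomorphicRepData n K hcpt, π.1.IsLAlgebraic ∧ ∀ᶠ v : IsDedekindDomain.HeightOneSpectrum (NumberField.RingOfIntegers K) in Filter.cofinite, Summit.Langlands.SatakeFrobCompatibleAt ι π.1 ρ v := by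
  sorry

/-- n = 2 over K ≠ ℚ: GL₂-type constituents of Tate modules over number fields — elliptic curves over real quadratic K (Freitas–Le Hung–Siksek 2015), totally real cubic / most quartic, imaginary quadratic K (Caraiani–Newton 2023), GL₂-type over TR fields partially; OPEN for K neither totally real nor CM (no construction of automorphic Galois representations) -/
theorem stub_abelianReciprocity_dimTwo_higherField :
    ∀ (K : Type) [Field K] [NumberField K] (n : ℕ) (hcpt : Literature.NumberTheory.Automorphic.isCompact_glFiniteIntegralLevel n K), 0 < n → ∀ (ℓ : ℕ) [Fact ℓ.Prime] (ι : PadicAlgCl ℓ ≃+* ℂ) (ρ : Literature.NumberTheory.GaloisRepresentations.FramedGaloisRep K (PadicAlgCl ℓ) n), ρ.toGaloisRep.IsIrreducible → n = 2 → Module.finrank ℚ K ≠ 1 → ((∀ᶠ v : IsDedekindDomain.HeightOneSpectrum (NumberField.RingOfIntegers K) in Filter.cofinite, ρ.IsUnramifiedAt v) ∧ ∀ (v : IsDedekindDomain.HeightOneSpectrum (NumberField.RingOfIntegers K)) (hv : ((ℓ : ℕ) : NumberField.RingOfIntegers K) ∈ v.asIdeal), (Literature.NumberTheory.PAdicHodge.fontainePstAdicCompletion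 v ℓ hv).IsDeRhamFramed (ρ.toLocal v)) → (∃ (d : ℕ) (X : Literature.AlgebraicGeometry.Motives.SchemeOver K), Literature.AlgebraicGeometry.Motives.IsSmoothProjective d X ∧ ∃ (j : ℤ) (W : Submodule (PadicAlgCl ℓ) (TensorProduct ℚ_[ℓ] (PadicAlgCl ℓ) (Literature.AlgebraicGeometry.Motives.ellAdicEtaleCohomologyRat ℓ 1 (Literature.AlgebraicGeometry.Motives.geometricFibre K X)))) (hW : ∀ (g : Field.absoluteGaloisGroup K) (w : TensorProduct ℚ_[ℓ] (PadicAlgCl ℓ) (Literature.AlgebraicGeometry.Motives.ellAdicEtaleCohomologyRat ℓ 1 (Literature.AlgebraicGeometry.Motives.geometricFibre K X))), w ∈ W → (algebraMap ℚ_[ℓ] (PadicAlgCl ℓ) ((Literature.AlgebraicGeometry.Motives.padicCyclotomicCharacter K ℓ g : ℚ_[ℓ]ˣ) : ℚ_[ℓ])) ^ j • (Literature.AlgebraicGeometry.Motives.geometricEllAdicEtaleCohomologyRepRat ℓ X 1 g).baseChange (PadicAlgCl ℓ) w ∈ W) (f : W →ₗ[PadicAlgCl ℓ] (Fin n → PadicAlgCl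 ℓ)), Function.Surjective f ∧ ∀ (g : Field.absoluteGaloisGroup K) (w : W), f ⟨(algebraMap ℚ_[ℓ] (PadicAlgCl ℓ) ((Literature.AlgebraicGeometry.Motives.padicCyclotomicCharacter K ℓ g : ℚ_[ℓ]ˣ) : ℚ_[ℓ])) ^ j • (Literature.AlgebraicGeometry.Motives.geometricEllAdicEtaleCohomologyRepRat ℓ X 1 g).baseChange (PadicAlgCl ℓ) (w : TensorProduct ℚ_[ℓ] (PadicAlgCl ℓ) (Literature.AlgebraicGeometry.Motives.ellAdicEtaleCohomologyRat ℓ 1 (Literature.AlgebraicGeometry.Motives.geometricFibre K X))), hW g w w.2⟩ = ((ρ g : GL (Fin n) (PadicAlgCl ℓ)) : Matrix (Fin n) (Fin n) (PadicAlgCl ℓ)).mulVec (f w)) → ∃ π : Literature.NumberTheory.Automorphic.CuspidalAutomorphicRepData n K hcpt, π.1.IsLAlgebraic ∧ ∀ᶠ v : IsDedekindDomain.HeightOneSpectrum (NumberField.RingOfIntegers K) in Filter.cofinite, Summit.Langlands.SatakeFrobCompatibleAt ι π.1 ρ v := by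
  sorry

/-- n ≠ 2: n = 1 (CM constituents / algebraic Hecke characters: = leaf RankOneAutomorphy 24805 restricted), abelian surfaces n = 4 over TR K (BCGP 2021 potential, BCGP 2025 positive proportion over ℚ), g ≥ 3 abelian-variety type (NonRegularWeightBarrier, no engine) -/
theorem stub_abelianReciprocity_otherDim :
    ∀ (K : Type) [Field K] [NumberField K] (n : ℕ) (hcpt : Literature.NumberTheory.Automorphic.isCompact_glFiniteIntegralLevel n K), 0 < n → ∀ (ℓ : ℕ) [Fact ℓ.Prime] (ι : PadicAlgCl ℓ ≃+* ℂ) (ρ : Literature.NumberTheory.GaloisRepresentations.FramedGaloisRep K (PadicAlgCl ℓ) n), ρ.toGaloisRep.IsIrreducible → n ≠ 2 → ((∀ᶠ v : IsDedekindDomain.HeightOneSpectrum (NumberField.RingOfIntegers K) in Filter.cofinite, ρ.IsUnramifiedAt v) ∧ ∀ (v : IsDedekindDomain.HeightOneSpectrum (NumberField.RingOfIntegers K)) (hv : ((ℓ : ℕ) : NumberField.RingOfIntegers K) ∈ v.asIdeal), (Literature.NumberTheory.PAdicHodge.fontainePstAdicCompletion v ℓ hv).IsDeRhamFramed (ρ.toLocal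 v)) → (∃ (d : ℕ) (X : Literature.AlgebraicGeometry.Motives.SchemeOver K), Literature.AlgebraicGeometry.Motives.IsSmoothProjective d X ∧ ∃ (j : ℤ) (W : Submodule (PadicAlgCl ℓ) (TensorProduct ℚ_[ℓ] (PadicAlgCl ℓ) (Literature.AlgebraicGeometry.Motives.ellAdicEtaleCohomologyRat ℓ 1 (Literature.AlgebraicGeometry.Motives.geometricFibre K X)))) (hW : ∀ (g : Field.absoluteGaloisGroup K) (w : TensorProduct ℚ_[ℓ] (PadicAlgCl ℓ) (Literature.AlgebraicGeometry.Motives.ellAdicEtaleCohomologyRat ℓ 1 (Literature.AlgebraicGeometry.Motives.geometricFibre K X))), w ∈ W → (algebraMap ℚ_[ℓ] (PadicAlgCl ℓ) ((Literature.AlgebraicGeometry.Motives.padicCyclotomicCharacter K ℓ g : ℚ_[ℓ]ˣ) : ℚ_[ℓ])) ^ j • (Literature.AlgebraicGeometry.Motives.geometricEllAdicEtaleCohomologyRepRat ℓ X 1 g).baseChange (PadicAlgCl ℓ) w ∈ W) (f : W →ₗ[PadicAlgCl ℓ] (Fin n → PadicAlgCl ℓ)), Function.Surjective f ∧ ∀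 (g : Field.absoluteGaloisGroup K) (w : W), f ⟨(algebraMap ℚ_[ℓ] (PadicAlgCl ℓ) ((Literature.AlgebraicGeometry.Motives.padicCyclotomicCharacter K ℓ g : ℚ_[ℓ]ˣ) : ℚ_[ℓ])) ^ j • (Literature.AlgebraicGeometry.Motives.geometricEllAdicEtaleCohomologyRepRat ℓ X 1 g).baseChange (PadicAlgCl ℓ) (w : TensorProduct ℚ_[ℓ] (PadicAlgCl ℓ) (Literature.AlgebraicGeometry.Motives.ellAdicEtaleCohomologyRat ℓ 1 (Literature.AlgebraicGeometry.Motives.geometricFibre K X))), hW g w w.2⟩ = ((ρ g : GL (Fin n) (PadicAlgCl ℓ)) : Matrix (Fin n) (Fin n) (PadicAlgCl ℓ)).mulVec (f w)) → ∃ π : Literature.NumberTheory.Automorphic.CuspidalAutomorphicRepData n K hcpt, π.1.IsLAlgebraic ∧ ∀ᶠ v : IsDedekindDomain.HeightOneSpectrum (NumberField.RingOfIntegers K) in Filter.cofinite, Summit.Langlands.SatakeFrobCompatibleAt ι π.1 ρ v := by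
  sorry

set_option maxHeartbeats 1000000 in
theorem AbelianMotivicReciprocity_of (h1 : ∀ (K : Type) [Field K] [NumberField K] (n : ℕ) (hcpt : Literature.NumberTheory.Automorphic.isCompact_glFiniteIntegralLevel n K), 0 < n → ∀ (ℓ : ℕ) [Fact ℓ.Prime] (ι : PadicAlgCl ℓ ≃+* ℂ) (ρ : Literature.NumberTheory.GaloisRepresentations.FramedGaloisRep K (PadicAlgCl ℓ) n), ρ.toGaloisRep.IsIrreducible → n = 2 → Module.finrank ℚ K = 1 → ((∀ᶠ v : IsDedekindDomain.HeightOneSpectrum (NumberField.RingOfIntegers K) in Filter.cofinite, ρ.IsUnramifiedAt v) ∧ ∀ (v : IsDedekindDomain.HeightOneSpectrum (NumberField.RingOfIntegers K)) (hv : ((ℓ : ℕ) : NumberField.RingOfIntegers K) ∈ v.asIdeal), (Literature.NumberTheory.PAdicHodge.fontainePstAdicCompletion v ℓ hv).IsDeRhamFramed (ρ.toLocal v)) → (∃ (d : ℕ) (X : Literature.AlgebraicGeometry.Motives.SchemeOver K), Literature.AlgebraicGeometry.Motives.IsSmoothProjective d X ∧ ∃ (j : ℤ) (W : Submodule (PadicAlgCl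 ℓ) (TensorProduct ℚ_[ℓ] (PadicAlgCl ℓ) (Literature.AlgebraicGeometry.Motives.ellAdicEtaleCohomologyRat ℓ 1 (Literature.AlgebraicGeometry.Motives.geometricFibre K X)))) (hW : ∀ (g : Field.absoluteGaloisGroup K) (w : TensorProduct ℚ_[ℓ] (PadicAlgCl ℓ) (Literature.AlgebraicGeometry.Motives.ellAdicEtaleCohomologyRat ℓ 1 (Literature.AlgebraicGeometry.Motives.geometricFibre K X))), w ∈ W → (algebraMap ℚ_[ℓ] (PadicAlgCl ℓ) ((Literature.AlgebraicGeometry.Motives.padicCyclotomicCharacter K ℓ g : ℚ_[ℓ]ˣ) : ℚ_[ℓ])) ^ j • (Literature.AlgebraicGeometry.Motives.geometricEllAdicEtaleCohomologyRepRat ℓ X 1 g).baseChange (PadicAlgCl ℓ) w ∈ W) (f : W →ₗ[PadicAlgCl ℓ] (Fin n → PadicAlgCl ℓ)), Function.Surjective f ∧ ∀ (g : Field.absoluteGaloisGroup K) (w : W), f ⟨(algebraMap ℚ_[ℓ] (PadicAlgCl ℓ) ((Literature.AlgebraicGeometry.Motives.padicCyclotomicCharacter K ℓ g : ℚ_[ℓ]ˣ)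 : ℚ_[ℓ])) ^ j • (Literature.AlgebraicGeometry.Motives.geometricEllAdicEtaleCohomologyRepRat ℓ X 1 g).baseChange (PadicAlgCl ℓ) (w : TensorProduct ℚ_[ℓ] (PadicAlgCl ℓ) (Literature.AlgebraicGeometry.Motives.ellAdicEtaleCohomologyRat ℓ 1 (Literature.AlgebraicGeometry.Motives.geometricFibre K X))), hW g w w.2⟩ = ((ρ g : GL (Fin n) (PadicAlgCl ℓ)) : Matrix (Fin n) (Fin n) (PadicAlgCl ℓ)).mulVec (f w)) → ∃ π : Literature.NumberTheory.Automorphic.CuspidalAutomorphicRepData n K hcpt, π.1.IsLAlgebraic ∧ ∀ᶠ v : IsDedekindDomain.HeightOneSpectrum (NumberField.RingOfIntegers K) in Filter.cofinite, Summit.Langlands.SatakeFrobCompatibleAt ι π.1 ρ v) (h2 : ∀ (K : Type) [Field K] [NumberField K] (n : ℕ) (hcpt : Literature.NumberTheory.Automorphic.isCompact_glFiniteIntegralLevel n K), 0 < n → ∀ (ℓ : ℕ) [Fact ℓ.Prime] (ι : PadicAlgCl ℓ ≃+* ℂ) (ρ : Literature.NumberTheory.GaloisRepresentations.FramedGaloisRep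 K (PadicAlgCl ℓ) n), ρ.toGaloisRep.IsIrreducible → n = 2 → Module.finrank ℚ K ≠ 1 → ((∀ᶠ v : IsDedekindDomain.HeightOneSpectrum (NumberField.RingOfIntegers K) in Filter.cofinite, ρ.IsUnramifiedAt v) ∧ ∀ (v : IsDedekindDomain.HeightOneSpectrum (NumberField.RingOfIntegers K)) (hv : ((ℓ : ℕ) : NumberField.RingOfIntegers K) ∈ v.asIdeal), (Literature.NumberTheory.PAdicHodge.fontainePstAdicCompletion v ℓ hv).IsDeRhamFramed (ρ.toLocal v)) → (∃ (d : ℕ) (X : Literature.AlgebraicGeometry.Motives.SchemeOver K), Literature.AlgebraicGeometry.Motives.IsSmoothProjective d X ∧ ∃ (j : ℤ) (W : Submodule (PadicAlgCl ℓ) (TensorProduct ℚ_[ℓ] (PadicAlgCl ℓ) (Literature.AlgebraicGeometry.Motives.ellAdicEtaleCohomologyRat ℓ 1 (Literature.AlgebraicGeometry.Motives.geometricFibre K X)))) (hW : ∀ (g : Field.absoluteGaloisGroup K) (w : TensorProduct ℚ_[ℓ] (PadicAlgCl ℓ) (Literature.AlgebraicGeometry.Motives.ellAdicEtaleCohomologyRat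 ℓ 1 (Literature.AlgebraicGeometry.Motives.geometricFibre K X))), w ∈ W → (algebraMap ℚ_[ℓ] (PadicAlgCl ℓ) ((Literature.AlgebraicGeometry.Motives.padicCyclotomicCharacter K ℓ g : ℚ_[ℓ]ˣ) : ℚ_[ℓ])) ^ j • (Literature.AlgebraicGeometry.Motives.geometricEllAdicEtaleCohomologyRepRat ℓ X 1 g).baseChange (PadicAlgCl ℓ) w ∈ W) (f : W →ₗ[PadicAlgCl ℓ] (Fin n → PadicAlgCl ℓ)), Function.Surjective f ∧ ∀ (g : Field.absoluteGaloisGroup K) (w : W), f ⟨(algebraMap ℚ_[ℓ] (PadicAlgCl ℓ) ((Literature.AlgebraicGeometry.Motives.padicCyclotomicCharacter K ℓ g : ℚ_[ℓ]ˣ) : ℚ_[ℓ])) ^ j • (Literature.AlgebraicGeometry.Motives.geometricEllAdicEtaleCohomologyRepRat ℓ X 1 g).baseChange (PadicAlgCl ℓ) (w : TensorProduct ℚ_[ℓ] (PadicAlgCl ℓ) (Literature.AlgebraicGeometry.Motives.ellAdicEtaleCohomologyRat ℓ 1 (Literature.AlgebraicGeometry.Motives.geometricFibre K X))), hW g w w.2⟩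 = ((ρ g : GL (Fin n) (PadicAlgCl ℓ)) : Matrix (Fin n) (Fin n) (PadicAlgCl ℓ)).mulVec (f w)) → ∃ π : Literature.NumberTheory.Automorphic.CuspidalAutomorphicRepData n K hcpt, π.1.IsLAlgebraic ∧ ∀ᶠ v : IsDedekindDomain.HeightOneSpectrum (NumberField.RingOfIntegers K) in Filter.cofinite, Summit.Langlands.SatakeFrobCompatibleAt ι π.1 ρ v) (h3 : ∀ (K : Type) [Field K] [NumberField K] (n : ℕ) (hcpt : Literature.NumberTheory.Automorphic.isCompact_glFiniteIntegralLevel n K), 0 < n → ∀ (ℓ : ℕ) [Fact ℓ.Prime] (ι : PadicAlgCl ℓ ≃+* ℂ) (ρ : Literature.NumberTheory.GaloisRepresentations.FramedGaloisRep K (PadicAlgCl ℓ) n), ρ.toGaloisRep.IsIrreducible → n ≠ 2 → ((∀ᶠ v : IsDedekindDomain.HeightOneSpectrum (NumberField.RingOfIntegers K) in Filter.cofinite, ρ.IsUnramifiedAt v) ∧ ∀ (v : IsDedekindDomain.HeightOneSpectrum (NumberField.RingOfIntegers K)) (hv : ((ℓ : ℕ) : NumberField.RingOfIntegers K) ∈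 v.asIdeal), (Literature.NumberTheory.PAdicHodge.fontainePstAdicCompletion v ℓ hv).IsDeRhamFramed (ρ.toLocal v)) → (∃ (d : ℕ) (X : Literature.AlgebraicGeometry.Motives.SchemeOver K), Literature.AlgebraicGeometry.Motives.IsSmoothProjective d X ∧ ∃ (j : ℤ) (W : Submodule (PadicAlgCl ℓ) (TensorProduct ℚ_[ℓ] (PadicAlgCl ℓ) (Literature.AlgebraicGeometry.Motives.ellAdicEtaleCohomologyRat ℓ 1 (Literature.AlgebraicGeometry.Motives.geometricFibre K X)))) (hW : ∀ (g : Field.absoluteGaloisGroup K) (w : TensorProduct ℚ_[ℓ] (PadicAlgCl ℓ) (Literature.AlgebraicGeometry.Motives.ellAdicEtaleCohomologyRat ℓ 1 (Literature.AlgebraicGeometry.Motives.geometricFibre K X))), w ∈ W → (algebraMap ℚ_[ℓ] (PadicAlgCl ℓ) ((Literature.AlgebraicGeometry.Motives.padicCyclotomicCharacter K ℓ g : ℚ_[ℓ]ˣ) : ℚ_[ℓ])) ^ j • (Literature.AlgebraicGeometry.Motives.geometricEllAdicEtaleCohomologyRepRat ℓ X 1 g).baseChange (PadicAlgCl ℓ)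 w ∈ W) (f : W →ₗ[PadicAlgCl ℓ] (Fin n → PadicAlgCl ℓ)), Function.Surjective f ∧ ∀ (g : Field.absoluteGaloisGroup K) (w : W), f ⟨(algebraMap ℚ_[ℓ] (PadicAlgCl ℓ) ((Literature.AlgebraicGeometry.Motives.padicCyclotomicCharacter K ℓ g : ℚ_[ℓ]ˣ) : ℚ_[ℓ])) ^ j • (Literature.AlgebraicGeometry.Motives.geometricEllAdicEtaleCohomologyRepRat ℓ X 1 g).baseChange (PadicAlgCl ℓ) (w : TensorProduct ℚ_[ℓ] (PadicAlgCl ℓ) (Literature.AlgebraicGeometry.Motives.ellAdicEtaleCohomologyRat ℓ 1 (Literature.AlgebraicGeometry.Motives.geometricFibre K X))), hW g w w.2⟩ = ((ρ g : GL (Fin n) (PadicAlgCl ℓ)) : Matrix (Fin n) (Fin n) (PadicAlgCl ℓ)).mulVec (f w)) → ∃ π : Literature.NumberTheory.Automorphic.CuspidalAutomorphicRepData n K hcpt, π.1.IsLAlgebraic ∧ ∀ᶠ v : IsDedekindDomain.HeightOneSpectrum (NumberField.RingOfIntegers K) in Filter.cofinite, Summit.Langlands.SatakeFrobCompatibleAt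 ι π.1 ρ v) :
    id Summit.Langlands.Langlands.Theses.MotivicDictionarySplit.AbelianMotivicReciprocity := by
  dsimp only [id]
  intro K _ _ n hcpt hn ℓ _ ι ρ hirr hgeom hreal
  by_cases hn2 : n = 2
  · by_cases hK : Module.finrank ℚ K = 1
    · exact h1 K n hcpt hn ℓ ι ρ hirr hn2 hK hgeom hreal
    · exact h2 K n hcpt hn ℓ ι ρ hirr hn2 hK hgeom hreal
  · exact h3 K n hcpt hn ℓ ι ρ hirr hn2 hgeom hreal

/-- the ONE theorem concluding the route decl BY NAME, hypothesis-free (skeleton audit candidate); sorries live only in the stubs. -/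
theorem abelianMotivicReciprocity_proof : Summit.Langlands.Langlands.Theses.MotivicDictionarySplit.AbelianMotivicReciprocity :=
  AbelianMotivicReciprocity_of stub_abelianReciprocity_dimTwo_rational stub_abelianReciprocity_dimTwo_higherField stub_abelianReciprocity_otherDim

end Summit.Langlands.Langlands.Cruxes.AbelianMotivicReciprocity.Birth
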